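import Literature.NumberTheory.Rogawski1990.Ch13Sec1
import Literature.NumberTheory.Rogawski1990.Ch13Sec2
import Literature.NumberTheory.Rogawski1990.Ch13Sec8
import HarnessLib

/-!
# Rogawski 1990, Chapter 13 — BRIDGE between the parallel local carriers of the squad carpet:
# ★ `Ch13Sec1.LocalAmbient` ∕ `Ch13Sec1.Classification` ∕ ★ `Ch13Sec2.BaseChangeAmbient` (§13.1–13.2, seat TR-t05) and
# ★ `Ch13Sec8.LocalLiftingData` (§13.8, seat TR-t07): ONE definitional adapter and the field-by-field identifications as theorems

(J. D. Rogawski, *Automorphic Representations of Unitary Groups in Three Variables*, Ann. of Math. Stud. 123 (1990), §13.1 pp. 198–199,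
§13.2 p. 200, §13.8 pp. 213–227.)

Topic `NumberTheory/Rogawski1990`; namespace `Literature.NumberTheory.Rogawski1990.Ch13Bridge`.  BRIDGE FILE of the TR squad (cell
hodgecm-mathlib; squad ruling «bridge files»): imports only ★ files; contains ONE definitional adapter `ofAmbient` (an instantiation of the
§13.8 datum from the §13.1–13.2 data plus the sockets §13.8 adds) and `theorem`s identifying the parallel predicates; **no new `Prop`-valued
named fact, no `sorry`, no instance, no notation** (net debt 0).  Nothing here asserts any printed statement: the theorems are
definitional unfoldings (`Iff.rfl` ∕ `rfl` ∕ a `finsum` over a singleton) and one transport of THEOREM 13.1.1 (2)'s relation to §13.8's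
`CharIdentity` clause.

## What is bridged (rows of the squad lists `T/ROG/TR-t08/g0/BRIDGES-local.md` §1 «junction = instantiation def», §2 «packets on G_v»
## (`liftMem`∕`sgn` ↔ `Classification.xiH`∕`members`∕`pair`), B4 «orientation», and `T/ROG/TR-t07/g0/NOTES-Ch13Sec8.md` §1–§2)
* `ofAmbient A 𝒞 B tr trH trGt trEpsI MatchBC MatchTw MatchH IsUnitaryH alpha : Ch13Sec8.LocalLiftingData TGt TG TH` — the §13.8 «local
  situation» datum BUILT from t05's ambient `A` (E(G), Π(H), `ρ(θ)`, …), classification `𝒞` (`ξ_H`, `⟨ρ, ·⟩`) and base-change datum `B`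
  (`E_ε(G̃)`, `I_{ρ̃′}`), with the §13.1∕§13.2 PARAMETERS `tr`, `trH`, `trGt`, `MatchBC` («`φ → f`»), `MatchH` («`f → f^H`») and the sockets
  §13.8 adds on top (`trEpsI` = `Tr(I_ρ̃(φ)I_ρ̃(ε))` of line (1′), `MatchTw` = «`φ → φ^H`», `IsUnitaryH`, `alpha`): `liftMem ρ π := π ∈
  𝒞.members (𝒞.xiH ρ)`, `sgn := 𝒞.pair`, `trEpsI' ρ := trGt (B.indPrime ρ)`.  ORIENTATION (B4): both carpets write the transfer relation
  source-first, `MatchGH f fH` = `MatchH f fH` = «`f → f^H`», `MatchG φ f` = `MatchBC φ f` = «`φ → f`» — the adapter is the identity on them.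
* `members_ofAmbient` (`Π(ρ)` of §13.8 = `𝒞.members (ξ_H ρ)`), `isRegularTheta_iff` ∕ `isSemiregularTheta_iff` ∕ `isThetaSemiregular_iff`
  (§12.1 «regular ∕ semi-regular», «of the form `ρ(θ)`, `θ` semi-regular»: the two files' bodies coincide), `packetChar_ofAmbient`.
* `charIdentity_ofAmbient_of_thm1311_2`: t05's relation `Classification.Thm1311_2 tr trH MatchH` (THEOREM 13.1.1 (2) for all `ρ` in scope)
  yields §13.8's clause `CharIdentity ρ` («the character identity of Theorem 13.1.1(2) holds», Prop. 13.8.3) at every `ρ` in scope with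
  finite `ξ_H(ρ)`; and `thm1311_2_clause_of_charIdentity` the converse transport of the identity clause.
* `isLift_ofAmbient_iff_isCharLift`: for an element `P ∈ Π′(G)` whose member set is the singleton `{π}` with `⟨1, π⟩ = 1` (the case of a
  supercuspidal `π`, Props. 13.8.4 ∕ 13.8.10), §13.8's single-representation lift relation `IsLift π π̃` («`ψ_G(π) = π̃`») is t05's
  first-step lift `BaseChangeAmbient.IsCharLift … P π̃` (§13.2 p. 200) — the sign `s = ±1` being an integer in one file and a complex
  number in the other.
NOT bridged here (other rows ∕ later passes): the A-packet carrier ★ `LocalAPacket` (§13.8 has no A-packet statement), ★ `Ch12Sec7.Dict`,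
t08's `Ch14Sec1to5.LocalData` (parameter-style carriers: they meet `ofAmbient` by instantiation, BRIDGES-local §1), the global dictionaries.

## References
* [Rogawski1990] J. D. Rogawski, Ann. of Math. Stud. 123 (1990): §12.1 p. 172; §13.1 Thm. 13.1.1 pp. 198–199; §13.2 p. 200; §13.8 Props.
  13.8.3–13.8.4, 13.8.10 pp. 216–226.
-/

noncomputable section

namespace Literature.NumberTheory.Rogawski1990.Ch13Bridge

open Literature.NumberTheory.Rogawski1990.Ch13Sec1
open Literature.NumberTheory.Rogawski1990.Ch13Sec2
open Literature.NumberTheory.Rogawski1990.Ch13Sec8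

variable {TGt TG TH : Type}

/-! ## §1 The adapter: the §13.8 datum built from the §13.1–13.2 data -/

/-- **The §13.8 «local situation» datum instantiated from the §13.1 ambient `A`, the classification `𝒞` (output of Thm. 13.1.1) and the
§13.2 base-change datum `B`**, together with the §13.1∕§13.2 parameters `tr` (`χ_π`), `trH` (`χ_ρ`), `trGt` (`χ_{π̃ε}`), `MatchBC`
(«`φ → f`»), `MatchH` («`f → f^H`») and the extra sockets of §13.8: `trEpsI ρ φ = Tr(I_ρ̃(φ)I_ρ̃(ε))` (line (1′), Prop. 13.8.2), `MatchTw`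
(«`φ → φ^H`»), `IsUnitaryH` («`ρ₀ ∈ Π(H)` is unitary»), `alpha` (`α(ρ)`, Prop. 13.8.6).  Definitions: `Π(ρ) := ξ_H(ρ)` (`liftMem ρ π := π ∈
𝒞.members (𝒞.xiH ρ)`), `⟨ρ, π⟩ := 𝒞.pair ρ π`, `Tr(I_ρ̃′(φ)I_ρ̃′(ε)) := trGt (B.indPrime ρ) φ`; everything else is copied.
NAME CROSS-OVER (read once): the §13.8 FIELD `LocalLiftingData.MatchH` is «`φ → φ^H`» (here fed by the parameter `MatchTw`), whereas
the §13.1 PARAMETER called `MatchH` (as in `Classification.Thm1311_2 tr trH MatchH`) is «`f → f^H`» and feeds the §13.8 field `MatchGH`.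
[cite: Rogawski1990, §13.8 p. 213 (chunk p0206); §13.1 Thm. 13.1.1 p. 198 (chunk p0191); §13.2 p. 200 (chunk p0193)] -/
def ofAmbient (A : LocalAmbient.{0}) (𝒞 : Classification A) (B : BaseChangeAmbient A)
    (tr : A.Rep → TG → ℂ) (trH : A.PacketH → TH → ℂ) (trGt : B.RepGt → TGt → ℂ) (trEpsI : A.PacketH → TGt → ℂ)
    (MatchBC : TGt → TG → Prop) (MatchTw : TGt → TH → Prop) (MatchH : TG → TH → Prop)
    (IsUnitaryH : A.PacketH → Prop) (alpha : A.PacketH → ℤ) : LocalLiftingData TGt TG TH where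
  RepG := A.Rep
  IsSupercuspidal := A.IsSupercuspidal
  IsSquareIntegrable := A.IsSquareIntegrable
  trG := tr
  PacketH := A.PacketH
  IsUnitaryH := IsUnitaryH
  IsSquareIntegrableH := A.IsSquareIntegrableH
  cardH := A.cardH
  trH := trH
  CharE1 := A.CharE1
  rhoTheta := A.rhoTheta
  RepGt := B.RepGt
  IsSupercuspidalGt := B.IsSupercuspidalGt
  trEps := trGt
  trEpsI := trEpsI
  trEpsI' := fun ρ => trGt (B.indPrime ρ)
  MatchG := MatchBC
  MatchH := MatchTw
  MatchGH := MatchH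
  liftMem := fun ρ π => π ∈ 𝒞.members (𝒞.xiH ρ)
  sgn := 𝒞.pair
  alpha := alpha

section Identifications

variable (A : LocalAmbient.{0}) (𝒞 : Classification A) (B : BaseChangeAmbient A)
  (tr : A.Rep → TG → ℂ) (trH : A.PacketH → TH → ℂ) (trGt : B.RepGt → TGt → ℂ) (trEpsI : A.PacketH → TGt → ℂ)
  (MatchBC : TGt → TG → Prop) (MatchTw : TGt → TH → Prop) (MatchH : TG → TH → Prop)
  (IsUnitaryH : A.PacketH → Prop) (alpha : A.PacketH → ℤ)

/-! ## §2 Field-by-field identifications (definitional) -/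

/-- **`Π(ρ)` of §13.8 is `ξ_H(ρ)` of §13.1**: the member set of the adapter at `ρ` is `𝒞.members (𝒞.xiH ρ)`.
[cite: Rogawski1990, §13.1 p. 199 (chunk p0192) «the image of `ρ` under `ξ_H` will be denoted by `Π(ρ)`»] -/
theorem members_ofAmbient (ρ : A.PacketH) :
    (ofAmbient A 𝒞 B tr trH trGt trEpsI MatchBC MatchTw MatchH IsUnitaryH alpha).members ρ = 𝒞.members (𝒞.xiH ρ) :=
  Set.ext fun _ => Iff.rfl

/-- The sign `⟨ρ, π⟩` of §13.8 is `𝒞.pair ρ π`. [cite: Rogawski1990, §13.1 Thm. 13.1.1 (2) p. 198 (chunk p0191)] -/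
theorem sgn_ofAmbient (ρ : A.PacketH) (π : A.Rep) :
    (ofAmbient A 𝒞 B tr trH trGt trEpsI MatchBC MatchTw MatchH IsUnitaryH alpha).sgn ρ π = 𝒞.pair ρ π :=
  rfl

/-- `Tr(I_ρ̃′(φ)I_ρ̃′(ε))` of §13.8 is the twisted character of t05's `I_{ρ̃′} = B.indPrime ρ`.
[cite: Rogawski1990, §13.5 p. 207 (chunk p0200); §13.2 Prop. 13.2.2 (c) p. 200 (chunk p0193)] -/
theorem trEpsI'_ofAmbient (ρ : A.PacketH) (φ : TGt) :
    (ofAmbient A 𝒞 B tr trH trGt trEpsI MatchBC MatchTw MatchH IsUnitaryH alpha).trEpsI' ρ φ = trGt (B.indPrime ρ) φ :=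
  rfl

/-- «`θ` regular»: the §13.8 body and the §13.1 body (`CChar.IsRegular`) coincide. [cite: Rogawski1990, §12.1 p. 172 (chunk p0163)] -/
theorem isRegularTheta_iff (θ : CChar A.CharE1) :
    (ofAmbient A 𝒞 B tr trH trGt trEpsI MatchBC MatchTw MatchH IsUnitaryH alpha).IsRegularTheta θ ↔ θ.IsRegular :=
  Iff.rfl

/-- «`θ` semi-regular»: the §13.8 body and the §13.1 body (`CChar.IsSemiregular`) coincide. [cite: Rogawski1990, §12.1 p. 172 (chunk p0163)] -/
theorem isSemiregularTheta_iff (θ : CChar A.CharE1) :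
    (ofAmbient A 𝒞 B tr trH trGt trEpsI MatchBC MatchTw MatchH IsUnitaryH alpha).IsSemiregularTheta θ ↔ θ.IsSemiregular :=
  Iff.rfl

/-- «`ρ` is of the form `ρ(θ)` with `θ` semi-regular»: §13.8's `IsThetaSemiregular` is t05's `LocalAmbient.IsThetaSemiregular`.
[cite: Rogawski1990, §13.1 Prop. 13.1.3 (b) p. 199 (chunk p0192); Prop. 13.8.3 pp. 216–217 (chunk p0211)] -/
theorem isThetaSemiregular_iff (ρ : A.PacketH) :
    (ofAmbient A 𝒞 B tr trH trGt trEpsI MatchBC MatchTw MatchH IsUnitaryH alpha).IsThetaSemiregular ρ ↔ A.IsThetaSemiregular ρ :=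
  Iff.rfl

/-- `χ_{Π(ρ)}(f) = Σ_{π ∈ ξ_H(ρ)} χ_π(f)` on the adapter. [cite: Rogawski1990, Prop. 13.8.6 pp. 218–219 (chunk p0213)] -/
theorem packetChar_ofAmbient (ρ : A.PacketH) (f : TG) :
    (ofAmbient A 𝒞 B tr trH trGt trEpsI MatchBC MatchTw MatchH IsUnitaryH alpha).packetChar ρ f
      = ∑ᶠ π ∈ 𝒞.members (𝒞.xiH ρ), tr π f :=
  rfl

/-! ## §3 THEOREM 13.1.1 (2) (§13.1 relation) ↔ «the character identity of Theorem 13.1.1(2)» (§13.8 clause) -/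

/-- **Transport of THEOREM 13.1.1 (2)**: if t05's relation `Thm1311_2` holds for `(A, 𝒞)` with the parameters `tr, trH, MatchH`, then for
every `ρ` in its scope (`dim ρ ≠ 1`, `ρ` not exceptional) whose L-packet `ξ_H(ρ)` is finite, §13.8's clause `CharIdentity ρ` holds on the
adapter. [cite: Rogawski1990, §13.1 Thm. 13.1.1 (2) p. 198 (chunk p0191); Prop. 13.8.3 pp. 216–217 (chunk p0211)] -/
theorem charIdentity_ofAmbient_of_thm1311_2 (h : 𝒞.Thm1311_2 tr trH MatchH) (ρ : A.PacketH) (hρ : A.InScope ρ)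
    (hfin : (𝒞.members (𝒞.xiH ρ)).Finite) :
    (ofAmbient A 𝒞 B tr trH trGt trEpsI MatchBC MatchTw MatchH IsUnitaryH alpha).CharIdentity ρ :=
  ⟨hfin, fun f fH hm => (h ρ hρ).2 f fH hm⟩

/-- **Converse transport of the identity clause**: §13.8's `CharIdentity ρ` on the adapter gives the identity
`χ_ρ(f^H) = Σ_{π ∈ ξ_H(ρ)} ⟨ρ, π⟩ χ_π(f)` for all `f → f^H`, in t05's currency.
[cite: Rogawski1990, §13.1 Thm. 13.1.1 (2) p. 198 (chunk p0191); Prop. 13.8.3 pp. 216–217 (chunk p0211)] -/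
theorem thm1311_2_clause_of_charIdentity (ρ : A.PacketH)
    (h : (ofAmbient A 𝒞 B tr trH trGt trEpsI MatchBC MatchTw MatchH IsUnitaryH alpha).CharIdentity ρ) :
    ∀ (f : TG) (fH : TH), MatchH f fH → trH ρ fH = ∑ᶠ π ∈ 𝒞.members (𝒞.xiH ρ), (𝒞.pair ρ π : ℂ) * tr π f :=
  h.2

/-! ## §4 The single-representation lift of §13.8 ↔ the first-step lift of §13.2 -/

/-- On an element `P ∈ Π′(G)` with member set `{π}` and `⟨1, π⟩ = 1`, t05's packet trace is `χ_π`.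
[cite: Rogawski1990, §13.2 p. 200 (chunk p0193) «`Tr(Π(f)) = Σ_{π ∈ Π} ⟨1, π⟩ χ_π(f)`»] -/
theorem primeTrace_of_singleton (P : 𝒞.PrimePacket) (π : A.Rep) (hP : 𝒞.primeMembers P = {π}) (h1 : pairOne 𝒞 P π = 1)
    (f : TG) : primeTrace 𝒞 tr P f = tr π f := by
  unfold primeTrace
  rw [hP, finsum_mem_singleton, h1]
  simp

/-- **`IsLift π π̃` (§13.8, single tempered `π`) ↔ `IsCharLift … P π̃` (§13.2 first step) when `P`'s members are `{π}` with `⟨1, π⟩ = 1`**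
(the case of Props. 13.8.4 and 13.8.10: `π` supercuspidal, its L-packet a stable singleton).  The only difference between the two
files is the type of the sign `s = ±1` (`ℤ` in §13.8, `ℂ` in §13.2).
[cite: Rogawski1990, §13.2 p. 200 (chunk p0193); Prop. 13.8.4 p. 218 (chunk p0212); Prop. 13.8.10 p. 226 (chunk p0221)] -/
theorem isLift_ofAmbient_iff_isCharLift (P : 𝒞.PrimePacket) (π : A.Rep) (hP : 𝒞.primeMembers P = {π})
    (h1 : pairOne 𝒞 P π = 1) (πt : B.RepGt) :
    (ofAmbient A 𝒞 B tr trH trGt trEpsI MatchBC MatchTw MatchH IsUnitaryH alpha).IsLift π πt ↔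
      B.IsCharLift 𝒞 tr trGt MatchBC P πt := by
  constructor
  · rintro ⟨s, hs, h⟩
    refine ⟨(s : ℂ), ?_, fun φ f hm => ?_⟩
    · rcases hs with rfl | rfl
      · exact Or.inl (by simp)
      · exact Or.inr (by simp)
    · rw [primeTrace_of_singleton A 𝒞 tr P π hP h1]
      exact h φ f hm
  · rintro ⟨s, hs, h⟩
    rcases hs with rfl | rfl
    · refine ⟨1, Or.inl rfl, fun φ f hm => ?_⟩
      have := h φ f hm
      rw [primeTrace_of_singleton A 𝒞 tr P π hP h1] at this
      show ((1 : ℤ) : ℂ) * trGt πt φ = tr π f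
      simpa using this
    · refine ⟨-1, Or.inr rfl, fun φ f hm => ?_⟩
      have := h φ f hm
      rw [primeTrace_of_singleton A 𝒞 tr P π hP h1] at this
      show ((-1 : ℤ) : ℂ) * trGt πt φ = tr π f
      simpa using this

end Identifications

end Literature.NumberTheory.Rogawski1990.Ch13Bridge

end
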